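import Literature.NumberTheory.Automorphic.Liu2021.Def411WeilCarriers
import Literature.NumberTheory.GelbartRogawski1991.UnitaryDualPairWeilCoinvariantsReference
import Literature.RepresentationTheory.TwistedCoinvariantsIrreducible
import HarnessLib

/-!
# Irreducibility of [Liu2021, Def. 4.11]'s `ω(μ, ε, χ)` does not see the splitting: reduction to a reference section

Topic `NumberTheory/Automorphic/Liu2021`.  Theorems only (no definition, no record, no named fact, no `sorry`).

[Liu2021, Def. 4.11 (`FJcycle.tex` l. 2092–2096)] calls `ω(μ, ε, χ) := ⊗'_v ω(μ_v, ε_v, χ_v)` «an irreducible admissible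
representation», the local factors being irreducible by [Liu2021, App. D Lem. D.1 (l. 5227; (1) l. 5229 for non-vanishing)] and the restricted
tensor product by Flath's theorem.  In the tree the carrier `Def411WeilCarriers.omega … (hs) ε χ` with its action
`rho … (hs) ι ε χ` (`Liu2021/Def411WeilCarriers.lean`) is the space of `χ`-coinvariants `Ω(s, χ_W)` of the finite Weil
representation of the dual pair `U(J_V) × U(⟨lineOf ε⟩)` through an ABSTRACT compatible splitting family `s`
([GelbartRogawski1991, Prop. 3.1.1]); the stage-2 END displays of the Hodge/COR-CM transposition lane carry its
irreducibility as the binder `hirr`.  This file moves that irreducibility question OFF the abstract `s`: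

* (generic transport of irreducibility along character twists / `TwistedCoinv.mapEquiv` / surjective pull-backs:
  `RepresentationTheory/IrreducibleTwistTransport.lean`, `RepresentationTheory/TwistedCoinvariantsIrreducible.lean`);
* §1 `WeilCoinv.isIrreducible_weilCoinv_iff_reference` — for ANY finite-adelic reference section `s₀` over the pair's
  symplectic map (`hproj`) and the twist character `χ` with `pairSmall₁ s ∘ finPairToAdelic = s₀ ⊗ χ`
  (`exists_eq_twist_finPairSection`): **`Ω(s, χ')` is irreducible iff the `χ''`-coinvariants of `ω_f^{s₀}|_{U(J_W)}` are
  irreducible under `U(J_V)`** (`χ' = χ(1,·)·χ''`; from `exists_weilCoinv_equiv_reference` — the two differ by the twist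
  `χ(·,1)` — and `Representation.isIrreducible_iff_of_twist_equivariant`); `…_iff_reference'` chooses `χ'' := χ(1,·)⁻¹·χ'`;
* §2 `Def411WeilCarriers.rhoV_isIrreducible_iff_reference`, `rho_isIrreducible_iff_reference` (along a SURJECTIVE
  `ι : G →* U(J_V)(𝔸_{F,f})`, e.g. the diagonal-frame isomorphism of the face datum) and the one-way form
  **`rho_isIrreducible_of_reference`**: the END displays' `hirr` follows from the irreducibility of the reference
  coinvariant representation — which, for a section assembled from LOCAL splittings, is a restricted tensor product of
  the local maximal `χ_v`-quotients (`FinLocalSplittings.omegaPi_centralCoinv`) and so is governed by Lem. D.1 (l. 5227) place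
  by place and Flath's theorem (`IsRestrictedTensorProductRep.isIrreducible_holds`).

Nothing of [Liu2021] is asserted; HC_CM is not mentioned by this file.

## References
* [Liu2021] Y. Liu, *Fourier–Jacobi cycles and arithmetic relative trace formula*, Camb. J. Math. 9 (2021) =
  arXiv:2102.11518: Def. 4.11 (l. 2083–2097), App. D §D.1 Steps 1∕2∕3 (l. 5217∕5219∕5221), Lem. D.1 (l. 5227; (1) l. 5229 for non-vanishing).
* [GelbartRogawski1991] S. Gelbart, J. Rogawski, Invent. Math. 105 (1991), §3.1 Prop. 3.1.1 p. 455, Remark p. 457 L4–13.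
* [Bump1997] D. Bump, *Automorphic forms and representations* (1997), §4.2 (twists), Thm. 3.4.4 (Flath).
-/

noncomputable section

/-! ## §1 `Ω(s, χ')` is irreducible iff the reference coinvariants are -/

section GR

open Literature.NumberTheory.GelbartRogawski1991 Literature.NumberTheory.GelbartRogawski1991.UnitaryDualPair
open Literature.NumberTheory.Automorphic Literature.NumberTheory.Weil1964
open Literature.RepresentationTheory
open scoped Kronecker
open NumberField IsDedekindDomain

namespace Literature.NumberTheory.GelbartRogawski1991.UnitaryDualPair.WeilCoinv

variable (F E : Type) [Field F] [NumberField F] [Field E] [NumberField E] [Algebra F E]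
variable (c : E ≃ₐ[F] E) (N M : ℕ) {n : ℕ} (e : Fin N × Fin M ≃ Fin n)
variable (JV : Matrix (Fin N) (Fin N) E) (JW : Matrix (Fin M) (Fin M) E)
variable {TV : Matrix (Fin N) (Fin N) F} {TW : Matrix (Fin M) (Fin M) F}
variable [Algebra.IsQuadraticExtension F E] {δ : E} (hcδ : c δ = -δ) (hδ : δ ≠ 0) {d : F}
  (hd : δ * δ = algebraMap F E d) (hV : TV.IsSymm) (hW : TW.IsSymm) (hVd : IsUnit TV.det) (hWd : IsUnit TW.det)
  (hJV : JV = TV.map (algebraMap F E)) (hJW : JW = TW.map (algebraMap F E))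
  {s : UnitaryGroup.adelicPair F E c N M JV JW →* adelicMpCont F (Fin n) (adelicGram F e TV TW)}
  {s₀ : UnitaryGroup.finAdelic F E c N JV × UnitaryGroup.finAdelic F E c M JW →*
    adelicMpCont F (Fin N × Fin M)
      (TV.map (algebraMap F (AdeleRing (𝓞 F) F)) ⊗ₖ TW.map (algebraMap F (AdeleRing (𝓞 F) F)))}
  (hproj : ∀ p, adelicMpCont.proj F (Fin N × Fin M) _ (s₀ p) =
    adelicMpCont.proj F (Fin N × Fin M) _ (((pairSmall₁ F E c N M e JV JW s).comp (finPairToAdelic F E c N M JV JW)) p))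
  {χ : UnitaryGroup.finAdelic F E c N JV × UnitaryGroup.finAdelic F E c M JW →* ℂˣ}
  (hχ : (pairSmall₁ F E c N M e JV JW s).comp (finPairToAdelic F E c N M JV JW) = adelicMpCont.twist F (Fin N × Fin M) _ s₀ χ)
  (hs : (splittingDatum F E c N M e JV JW hcδ hδ hd hV hW hVd hWd hJV hJW).IsCompatible s)
  {χ' χ'' : UnitaryGroup.finAdelic F E c M JW →* ℂˣ} (hχ' : ∀ u, χ' u = χ (1, u) * χ'' u)

include hχ hχ' in
/-- **`Ω(s, χ')` is irreducible iff the reference coinvariant representation is**: for a reference section `s₀` over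
the pair's symplectic map with `pairSmall₁ s ∘ finPairToAdelic = s₀ ⊗ χ` and `χ' = χ(1,·)·χ''`, the `U(J_V)(𝔸_{F,f})`-
representation `weilCoinv χ' hs` on `Ω(s, χ')` is irreducible iff the induced `U(J_V)(𝔸_{F,f})`-action on
`Coinv(ω_f^{s₀}|_{U(J_W)}, χ'')` is — the two are isomorphic up to the twist `χ(·, 1)`
(`exists_weilCoinv_equiv_reference`), and a character twist does not affect irreducibility.
[cite: GelbartRogawski1991, §3.1 Remark p. 457 L4–13; Liu2021, Def. 4.11 (l. 2092–2096)] -/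
theorem isIrreducible_weilCoinv_iff_reference :
    (weilCoinv F E c N M e JV JW hcδ hδ hd hV hW hVd hWd hJV hJW χ' hs).IsIrreducible ↔
      (TwistedCoinv.rep χ''
        ((finRepMp (isUnit_kronecker_map F N hVd hWd) s₀
          (harch_reference F E c N M e JV JW hcδ hδ hd hV hW hVd hWd hJV hJW s₀ hproj hs)).comp (MonoidHom.inl _ _))
        (commute_comp_inl_comp_inr _)).IsIrreducible := by
  obtain ⟨T, -, hT⟩ :=
    exists_weilCoinv_equiv_reference F E c N M e JV JW hcδ hδ hd hV hW hVd hWd hJV hJW hproj hχ hs hχ'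
  exact Representation.isIrreducible_iff_of_twist_equivariant _ _ (MonoidHom.id _) Function.surjective_id T
    (fun k => χ (k, 1)) fun k x => hT k x

include hχ in
/-- The same with the reference character CHOSEN as `χ'' := χ(1,·)⁻¹ · χ'` (any `χ'`).
[cite: GelbartRogawski1991, §3.1 Remark p. 457 L4–13; Liu2021, Def. 4.11 (l. 2092–2096)] -/
theorem isIrreducible_weilCoinv_iff_reference' (χ' : UnitaryGroup.finAdelic F E c M JW →* ℂˣ) :
    (weilCoinv F E c N M e JV JW hcδ hδ hd hV hW hVd hWd hJV hJW χ' hs).IsIrreducible ↔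
      (TwistedCoinv.rep ((χ.comp (MonoidHom.inr _ _))⁻¹ * χ')
        ((finRepMp (isUnit_kronecker_map F N hVd hWd) s₀
          (harch_reference F E c N M e JV JW hcδ hδ hd hV hW hVd hWd hJV hJW s₀ hproj hs)).comp (MonoidHom.inl _ _))
        (commute_comp_inl_comp_inr _)).IsIrreducible :=
  isIrreducible_weilCoinv_iff_reference F E c N M e JV JW hcδ hδ hd hV hW hVd hWd hJV hJW hproj hχ hs fun u => by
    rw [MonoidHom.mul_apply, MonoidHom.inv_apply, MonoidHom.comp_apply, MonoidHom.inr_apply, ← mul_assoc,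
      mul_inv_cancel, one_mul]

end Literature.NumberTheory.GelbartRogawski1991.UnitaryDualPair.WeilCoinv

end GR

/-! ## §2 [Liu2021, Def. 4.11]'s `rho … ι ε χ`: irreducibility from a reference section -/

section Liu

open NumberField IsDedekindDomain
open scoped Kronecker
open Literature.NumberTheory Literature.NumberTheory.Automorphic
open Literature.NumberTheory.GelbartRogawski1991 Literature.NumberTheory.GelbartRogawski1991.UnitaryDualPair
open Literature.NumberTheory.GelbartRogawski1991.UnitaryDualPair.WeilCoinv
open Literature.NumberTheory.Weil1964 Literature.RepresentationTheory

namespace Literature.NumberTheory.Automorphic.Liu2021.Def411WeilCarriers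

variable (F E : Type) [Field F] [NumberField F] [Field E] [NumberField E] [Algebra F E]
variable (c : E ≃ₐ[F] E) (N : ℕ) {n : ℕ} (e : Fin N × Fin 1 ≃ Fin n)
variable (JV : Matrix (Fin N) (Fin N) E) {TV : Matrix (Fin N) (Fin N) F}
variable [Algebra.IsQuadraticExtension F E] {δ : E} (hcδ : c δ = -δ) (hδ : δ ≠ 0) {d : F}
  (hd : δ * δ = algebraMap F E d) (hV : TV.IsSymm) (hVd : IsUnit TV.det) (hJV : JV = TV.map (algebraMap F E))
variable {s : ∀ a : Fˣ, UnitaryGroup.adelicPair F E c N 1 JV (JW F E a) →* adelicMpCont F (Fin n) (adelicGram F e TV (TW F a))}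
  (hs : ∀ a : Fˣ, (splittingDatum F E c N 1 e JV (JW F E a) hcδ hδ hd hV (isSymm_TW F a) hVd (isUnit_det_TW F a) hJV
    (JW_eq F E a)).IsCompatible (s a))
variable (ε : Eps F d) (χ : Chi F E c)
/- a finite-adelic REFERENCE SECTION of the pair `(V, ⟨lineOf ε⟩)` over its symplectic map, and the twist character
`χtw` with `pairSmall₁ (s (lineOf ε)) ∘ finPairToAdelic = s₀ ⊗ χtw` (`exists_eq_twist_finPairSection`). -/
variable {s₀ : UnitaryGroup.finAdelic F E c N JV × UnitaryGroup.finAdelic F E c 1 (JW F E (lineOf F d ε)) →*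
    adelicMpCont F (Fin N × Fin 1)
      (TV.map (algebraMap F (AdeleRing (𝓞 F) F)) ⊗ₖ (TW F (lineOf F d ε)).map (algebraMap F (AdeleRing (𝓞 F) F)))}
  (hproj : ∀ p, adelicMpCont.proj F (Fin N × Fin 1) _ (s₀ p) =
    adelicMpCont.proj F (Fin N × Fin 1) _
      (((pairSmall₁ F E c N 1 e JV (JW F E (lineOf F d ε)) (s (lineOf F d ε))).comp
        (finPairToAdelic F E c N 1 JV (JW F E (lineOf F d ε)))) p))
  {χtw : UnitaryGroup.finAdelic F E c N JV × UnitaryGroup.finAdelic F E c 1 (JW F E (lineOf F d ε)) →* ℂˣ}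
  (hχtw : (pairSmall₁ F E c N 1 e JV (JW F E (lineOf F d ε)) (s (lineOf F d ε))).comp
      (finPairToAdelic F E c N 1 JV (JW F E (lineOf F d ε))) =
    adelicMpCont.twist F (Fin N × Fin 1) _ s₀ χtw)

include hχtw in
/-- **`ω(μ, ε, χ)` (with its `U(J_V)(𝔸_{F,f})`-action `rhoV`) is irreducible iff the reference coinvariant
representation is** — reference character `χtw(1,·)⁻¹ · χ_W`, `χ_W = lineChar (lineOf ε) χ`.
[cite: Liu2021, Def. 4.11 (l. 2092–2096); App. D §D.1 Step 3 (l. 5221); GelbartRogawski1991, §3.1 Remark p. 457 L4–13] -/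
theorem rhoV_isIrreducible_iff_reference :
    (rhoV F E c N e JV hcδ hδ hd hV hVd hJV hs ε χ).IsIrreducible ↔
      (TwistedCoinv.rep ((χtw.comp (MonoidHom.inr _ _))⁻¹ * lineChar F E c (lineOf F d ε) χ.1)
        ((finRepMp (isUnit_kronecker_map F N hVd (isUnit_det_TW F (lineOf F d ε))) s₀
          (harch_reference F E c N 1 e JV (JW F E (lineOf F d ε)) hcδ hδ hd hV (isSymm_TW F _) hVd
            (isUnit_det_TW F _) hJV (JW_eq F E _) s₀ hproj (hs (lineOf F d ε)))).comp (MonoidHom.inl _ _))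
        (commute_comp_inl_comp_inr _)).IsIrreducible :=
  isIrreducible_weilCoinv_iff_reference' F E c N 1 e JV (JW F E (lineOf F d ε)) hcδ hδ hd hV (isSymm_TW F _) hVd
    (isUnit_det_TW F _) hJV (JW_eq F E _) hproj hχtw (hs (lineOf F d ε)) (lineChar F E c (lineOf F d ε) χ.1)

variable {G : Type*} [Group G] [TopologicalSpace G] {ι : G →* UnitaryGroup.finAdelic F E c N JV}
  (hι : Function.Surjective ι)

omit [TopologicalSpace G] in
include hχtw hι in
/-- **`rho … ι ε χ` is irreducible iff the reference coinvariant representation is**, for `ι : G →* U(J_V)(𝔸_{F,f})`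
SURJECTIVE (at the Appendix-C face datum `ι` is the diagonal-frame isomorphism `V.adelicFinDiag`).
[cite: Liu2021, Def. 4.11 (l. 2092–2096); App. C (l. 4624); GelbartRogawski1991, §3.1 Remark p. 457 L4–13] -/
theorem rho_isIrreducible_iff_reference :
    (rho F E c N e JV hcδ hδ hd hV hVd hJV hs ι ε χ).IsIrreducible ↔
      (TwistedCoinv.rep ((χtw.comp (MonoidHom.inr _ _))⁻¹ * lineChar F E c (lineOf F d ε) χ.1)
        ((finRepMp (isUnit_kronecker_map F N hVd (isUnit_det_TW F (lineOf F d ε))) s₀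
          (harch_reference F E c N 1 e JV (JW F E (lineOf F d ε)) hcδ hδ hd hV (isSymm_TW F _) hVd
            (isUnit_det_TW F _) hJV (JW_eq F E _) s₀ hproj (hs (lineOf F d ε)))).comp (MonoidHom.inl _ _))
        (commute_comp_inl_comp_inr _)).IsIrreducible :=
  (Representation.isIrreducible_comp_iff_of_surjective _ ι hι).trans
    (rhoV_isIrreducible_iff_reference F E c N e JV hcδ hδ hd hV hVd hJV hs ε χ hproj hχtw)

omit [TopologicalSpace G] in
include hχtw hι in
/-- **`hirr` from a reference section**: if the `U(J_V)(𝔸_{F,f})`-action on the `χtw(1,·)⁻¹·χ_W`-coinvariants of the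
reference Weil representation `ω_f^{s₀}` is irreducible, then `rho … ι ε χ = ω(μ, ε, χ)` is irreducible (`ι` surjective).
This is the junction through which [Liu2021, App. D Lem. D.1 (l. 5227)] place by place and Flath's theorem
(`IsRestrictedTensorProductRep.isIrreducible_holds`) deliver the END displays' binder `hirr`.
[cite: Liu2021, Def. 4.11 (l. 2092–2096); App. D Lem. D.1 (l. 5227; (1) l. 5229 for non-vanishing); GelbartRogawski1991, §3.1 Remark p. 457 L4–13] -/
theorem rho_isIrreducible_of_reference
    (h : (TwistedCoinv.rep ((χtw.comp (MonoidHom.inr _ _))⁻¹ * lineChar F E c (lineOf F d ε) χ.1)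
        ((finRepMp (isUnit_kronecker_map F N hVd (isUnit_det_TW F (lineOf F d ε))) s₀
          (harch_reference F E c N 1 e JV (JW F E (lineOf F d ε)) hcδ hδ hd hV (isSymm_TW F _) hVd
            (isUnit_det_TW F _) hJV (JW_eq F E _) s₀ hproj (hs (lineOf F d ε)))).comp (MonoidHom.inl _ _))
        (commute_comp_inl_comp_inr _)).IsIrreducible) :
    (rho F E c N e JV hcδ hδ hd hV hVd hJV hs ι ε χ).IsIrreducible :=
  (rho_isIrreducible_iff_reference F E c N e JV hcδ hδ hd hV hVd hJV hs ε χ hproj hχtw hι).2 h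

end Literature.NumberTheory.Automorphic.Liu2021.Def411WeilCarriers

end Liu

end
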